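import Literature.AlgebraicGeometry.ShimuraVarieties.UnitaryShimuraCurveEmbeddingInjectiveCofinal
import Literature.NumberTheory.Automorphic.UnitaryGroupFrameStabiliserLevel
import Literature.NumberTheory.Automorphic.UnitaryGroupFrameSubform
import HarnessLib

/-!
# Injectivity of the sub-ball embedding `Sh_{K⋆}(U(J⋆), 𝔻)(ℂ) → Sh_K(U(H), 𝔹²)(ℂ)` below a depth — HYPOTHESIS-FREE
# ([Del71] Prop. 1.15 for `U(W^⊥) ↪ U(V)`, injectivity on `ℂ`-points; road (ii) leaf R2-1-inj CLOSED)

Topic `AlgebraicGeometry/ShimuraVarieties`, namespace `…UnitaryCanonicalModel` (continuation of ★ (F-INJ) parts 1–3).  THEOREMS ONLY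
(no definition, no instance, no named fact, no `sorry`; books 0).  Cell `hodgecm-mathlib` (D-0151), road (ii) leaf R2-1-inj (census
`A-provers/A-p15/g7/CENSUS-R2-1-inj.A-p15g7.md`, A-plan2 dossier A.15).  HC_CM is proved only modulo the 7 printed citations until rung 0
closes; nothing here is in a registered cone.

★ PART 3 `ShimuraSetGS.embPoints_injective_of_le_levelB` proves the injectivity of `embPoints` at every trace pair below a depth of
the `B`-adapted principal family, conditionally on the case-(A) closer `hFA`.  ★ (F-A) `UnitaryGroupFrameStabiliserLevel`
(A-p02): `exists_eq_embRational_of_mulVec_frameEmb_of_mem_level_cm` — a rational witness stabilising `W^⊥ = B(L² ⊕ 0)` with its coset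
in a `B`-adapted principal level of depth `3 ≤ n` is `embRational γ⋆` (block-diagonal stabiliser; the `U(1)` centre part on `W` is a
norm-one unit `≡ 1 (mod n)`, hence `1` by Kronecker–Minkowski ★ `UnitaryGroupLevelDet`).  This file discharges `hFA` by that theorem:
`ShimuraSetGS.embPoints_injective_of_le_levelB_holds` needs only the face data — `H` anisotropic and definite off the place of `τ`, a
`(1,1)`-frame of `J⋆^τ`, `det J⊥ ≠ 0` (`det J⋆ ≠ 0` follows from the frame).

References: [Deligne1971TravauxShimura] Prop. 1.15 + proof pp. 132–133; [Milne2005ShimuraVarieties] Thm. 5.16, Lemma 5.13 p. 57;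
[PlatonovRapinchuk1994] §5.1.
-/

noncomputable section

open Function MulAction Matrix NumberField IsDedekindDomain
open scoped Matrix ComplexOrder Pointwise Topology
open Literature.Geometry.ComplexHyperbolic Literature.Geometry.ComplexHyperbolic.BallModel
open Literature.NumberTheory.Automorphic Literature.NumberTheory.Automorphic.UnitaryGroup

namespace Literature.AlgebraicGeometry.ShimuraVarieties

namespace UnitaryCanonicalModel

variable {L : Type} [Field L] [NumberField L] [IsCMField L] {H : Matrix (Fin 3) (Fin 3) L} {τ : L →+* ℂ} {T : GL (Fin 3) ℂ}

section Holds

variable (L H τ T) (hT : formCongr (starRingEnd ℂ) T (H.map τ) = BallModel.J)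
  (Jstar : Matrix (Fin 2) (Fin 2) L) (Jperp : Matrix (Fin 1) (Fin 1) L) (B : GL (Fin 3) L) {a : L} (ha : a ≠ 0)
  (hB : formCongr ((IsCMField.complexConj L : L ≃ₐ[↥(maximalRealSubfield L)] L) : L →+* L) B (a • H) =
    finSum 2 1 Jstar Jperp)
  (hτa : 0 < (τ a).re) (hτa' : (τ a).im = 0)

omit [NumberField L] [IsCMField L] in
/-- A `(1,1)`-frame of `J⋆^τ` forces `det J⋆ ≠ 0` (`det (ᵗT̄·J⋆^τ·T) = conj(det T)·τ(det J⋆)·det T = det diag(1,−1) = −1`).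
[cite: Dieudonne1971GroupesClassiques, Chap. II §5] -/
theorem det_ne_zero_of_frame_diagonal {Tstar : GL (Fin 2) ℂ}
    (hTstar : formCongr (starRingEnd ℂ) Tstar (Jstar.map τ) = Matrix.diagonal ![(1 : ℂ), -1]) : Jstar.det ≠ 0 := by
  intro h
  have hdet := det_formCongr (starRingEnd ℂ) Tstar (Jstar.map τ)
  have hmap : (Jstar.map τ).det = 0 := by
    have := RingHom.map_det τ Jstar
    rw [h, map_zero] at this
    rw [← RingHom.mapMatrix_apply, ← this]
  rw [hTstar, hmap, mul_zero, zero_mul, Matrix.det_diagonal] at hdet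
  norm_num [Fin.prod_univ_two] at hdet

/-- **[Del71] Prop. 1.15 (injectivity, `ℂ`-points) for the unitary sub-datum `U(W^⊥) ↪ U(V)` — HYPOTHESIS-FREE below a depth.**  For a
CM field `L`, `H ∈ M₃(L)` hermitian, ANISOTROPIC and positive definite at every complex place off that of `τ`, a frame
`ᵗ(cB)·(a·H)·B = J⋆ ⊕ J⊥` with `τ a > 0`, a `(1,1)`-frame `Tstar` of `J⋆^τ` and `det J⊥ ≠ 0`: there is a depth `m₀` such that for every
level `Tlev ≤ K_B((m₀+3)!)` of `U(H)(𝔸_f)` (`K_B(n)` = the `B`-adapted principal congruence level) and every level `K⋆` of `U(J⋆)(𝔸_f)`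
with `φGS(K⋆) ≤ Tlev` and `Tlev ∩ im φGS ⊆ φGS(K⋆)`, the embedding of Shimura sets
`ShimuraSetGS.embPoints : Sh_{K⋆}(U(J⋆),𝔻)(ℂ) → Sh_{Tlev}(U(H),𝔹²)(ℂ)` is INJECTIVE.  (= ★ PART 3 `…_of_le_levelB` with `hFA` discharged by
★ (F-A) `exists_eq_embRational_of_mulVec_frameEmb_of_mem_level_cm`.)  «pour `K²` assez petit»: `m₀` is existential (it bounds the
finitely many CM self-intersections of the immersed special curve at the base level).
[cite: Deligne1971TravauxShimura, Prop. 1.15 + proof pp. 132–133] [cite: Milne2005ShimuraVarieties, Thm. 5.16 and Lemma 5.13 p. 57] -/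
theorem ShimuraSetGS.embPoints_injective_of_le_levelB_holds
    (hanis : ∀ v : Fin 3 → L, hermForm (cmConjRingHom L) H v v = 0 → v = 0)
    (hpos : ∀ τ' : L →+* ℂ, InfinitePlace.mk τ' ≠ InfinitePlace.mk τ → (H.map τ').PosDef)
    {Tstar : GL (Fin 2) ℂ} (hTstar : formCongr (starRingEnd ℂ) Tstar (Jstar.map τ) = Matrix.diagonal ![(1 : ℂ), -1])
    (hJperp : Jperp.det ≠ 0) :
    ∃ m₀ : ℕ, ∀ Tlev : Subgroup ↥(finAdelic (↥(maximalRealSubfield L)) L (IsCMField.complexConj L) 3 H), Tlev ≤ ((finCongruenceLevel (↥(maximalRealSubfield L)) L (IsCMField.complexConj L) 3 (finSum 2 1 Jstar Jperp)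
        (Ideal.span {(((m₀ + 3).factorial : ℕ) : 𝓞 L)})).map (finAdelicCongr (↥(maximalRealSubfield L)) L (IsCMField.complexConj L) B ha hB).toMonoidHom) →
      ∀ (Kstar : Subgroup ↥(finAdelic (↥(maximalRealSubfield L)) L (IsCMField.complexConj L) 2 Jstar)) (hK : Kstar.map (φGS L Jstar Jperp H B ha hB) ≤ Tlev), Tlev.comap (φGS L Jstar Jperp H B ha hB) ≤ Kstar →
      Function.Injective (ShimuraSetGS.embPoints L H τ T hT Jstar Jperp B ha hB hτa hτa' Kstar Tlev hK) :=
  ShimuraSetGS.embPoints_injective_of_le_levelB L H τ T hT Jstar Jperp B ha hB hτa hτa' hanis hpos hTstar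
    fun _n hn _K hK γ u u' hV hcoset =>
      exists_eq_embRational_of_mulVec_frameEmb_of_mem_level_cm 2 L Jstar Jperp H B ha hB
        (det_ne_zero_of_frame_diagonal L τ Jstar hTstar) hJperp hn (φGS_apply L Jstar Jperp H B ha hB) hK γ u u' hV hcoset

end Holds

end UnitaryCanonicalModel

end Literature.AlgebraicGeometry.ShimuraVarieties

end
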